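import Literature.Probability.RandomPlanarGeometry.SAWBridgeRatioRate
import Mathlib.Analysis.SpecialFunctions.Pow.Real
import Mathlib.Analysis.SpecialFunctions.Pow.Asymptotics
import HarnessLib

/-!
# The polynomial rung of the bridge ratio rate: a Kesten tail rate `C m^{-δ}` gives `|b_{N+1}/b_N − μ| ≤ K N^{-δ/(4(1+δ))}`

Topic `Literature/Probability/RandomPlanarGeometry` (continues `SAWBridgeRatioRate.lean`).

Source: N. Madras, G. Slade, *The Self-Avoiding Walk* (1993), Theorem 7.3.4 (d) (book p. 248; held text
`book:madras1993-self-avoiding-walk` p0261:L12–L20) and its proof via (7.3.14) — a limit, no rate. The tree's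
`bridgeRatio_rate_log` gives the unconditional rate `K/log N`; the logarithm comes only from the unconditional
Kesten tail `1 − Σ_{k≤m} λ_k μ^{-k} = O(1/log m)` (`kestenTail_le_inv_log`).

## What is new in this file (not in print)

`bridgeRatio_rate_poly_of_kestenTail`: under a HYPOTHETICAL Kesten tail rate `1 − Σ_{k≤m} λ_k μ^{-k} ≤ C m^{-δ}`
(`0 < δ < 1`), the same quantitative sandwich (`Renewal.ratio_sandwich_sharp`) with window length
`T = ⌊N^{1/(4(1+δ))}⌋` gives the POLYNOMIAL rate `∃ K, ∀ N ≥ 1, |b_{N+1}/b_N − μ| ≤ K N^{-δ/(4(1+δ))}` on `ℤ^{d+2}`.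
(Lane «pcv-sawmu» route R16, conditional rung; a-idea-1 typed, a-p5 proved.)
-/

noncomputable section

open Finset Filter Topology Literature.Probability.LatticeModels
open scoped BigOperators

namespace Literature.Probability.RandomPlanarGeometry.SAW.Zd

/-- Elementary: for `z ≥ 2`, `4z + 2 ≤ z^4`. [folklore] -/
private theorem four_mul_add_two_le_pow_four' {z : ℝ} (hz : 2 ≤ z) : 4 * z + 2 ≤ z ^ 4 := by
  have h3 : (2 : ℝ) ^ 3 ≤ z ^ 3 := pow_le_pow_left₀ (by norm_num) hz 3
  have : z ^ 4 = z * z ^ 3 := by ring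
  nlinarith

/-! ### The polynomial rung: a Kesten tail RATE gives a polynomial one-step rate -/

/-- **Polynomial rung**: under a Kesten tail rate `1 − Σ_{k≤m} λ_k μ^{-k} ≤ C m^{-δ}` (`0 < δ < 1`; an open
hypothesis — the unconditional tail is only `O(1/log m)`), the same sandwich with window length
`T = ⌊N^{1/(4(1+δ))}⌋` gives the POLYNOMIAL rate `|b_{N+1}/b_N − μ| ≤ K N^{-δ/(4(1+δ))}` for all `N ≥ 1`.
[cite: MadrasSlade1993, Theorem 7.3.4 (d) (proof, eq. (7.3.14), quantitative form)] -/
theorem bridgeRatio_rate_poly_of_kestenTail (d : ℕ) {C δ : ℝ} (hC : 0 ≤ C) (hδ0 : 0 < δ) (hδ1 : δ < 1)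
    (hKT : ∀ m : ℕ, 1 ≤ m →
      1 - ∑ k ∈ Icc 1 m, (irreducibleBridgeCount (d + 2) k : ℝ) / connectiveConstant (d + 2) ^ k ≤
        C * (m : ℝ) ^ (-δ)) :
    ∃ K : ℝ, ∀ N : ℕ, 1 ≤ N →
      |(bridgeCount (d + 2) (N + 1) : ℝ) / bridgeCount (d + 2) N - connectiveConstant (d + 2)| ≤
        K * (N : ℝ) ^ (-(δ / (4 * (1 + δ)))) := by
  obtain ⟨K', hK', N₀, hU⟩ := exists_bridgeTwoStepUpperRate d
  set μ := connectiveConstant (d + 2) with hμdef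
  have hμ : 0 < μ := connectiveConstant_pos (d + 2)
  have hμ1 : 1 ≤ μ := one_le_connectiveConstant (d + 2)
  -- the exponent `a = 1/(4(1+δ))`, `1/4 − a = aδ`
  set a : ℝ := 1 / (4 * (1 + δ)) with hadef
  have h1δ : 0 < 1 + δ := by linarith
  have ha0 : 0 < a := by rw [hadef]; positivity
  have ha4 : a ≤ 1 / 4 := by
    rw [hadef, div_le_div_iff₀ (by positivity) (by norm_num)]; nlinarith
  have haδ : a * δ = δ / (4 * (1 + δ)) := by rw [hadef]; ring
  have hqa : (1 : ℝ) / 4 - a = a * δ := by rw [hadef]; field_simp; ring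
  have haδ0 : 0 < a * δ := mul_pos ha0 hδ0
  -- eventual side conditions in the shifted index `n = N + 1`
  set kk : ℕ → ℝ := fun n => 2 * K' * (n : ℝ) ^ (-(a * δ)) with hkk
  have hkklim : Tendsto kk atTop (𝓝 0) := by
    have := ((tendsto_rpow_neg_atTop haδ0).comp tendsto_natCast_atTop_atTop).const_mul (2 * K')
    simpa [hkk] using this
  have F1 : ∀ᶠ n : ℕ in atTop, max 2 μ ≤ (n : ℝ) ^ a :=
    ((tendsto_rpow_atTop ha0).comp tendsto_natCast_atTop_atTop).eventually_ge_atTop _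
  have F2 : ∀ᶠ n : ℕ in atTop, (2 : ℝ) ≤ (n : ℝ) ^ ((1 : ℝ) / 4) :=
    ((tendsto_rpow_atTop (by norm_num : (0 : ℝ) < 1 / 4)).comp tendsto_natCast_atTop_atTop).eventually_ge_atTop _
  have F3 : ∀ᶠ n : ℕ in atTop, 2 * N₀ ≤ n := eventually_ge_atTop _
  have F4 : ∀ᶠ n : ℕ in atTop, kk n < 1 / 2 := (tendsto_order.1 hkklim).2 _ (by norm_num)
  have F7 : ∀ᶠ n : ℕ in atTop, 2 ≤ n := eventually_ge_atTop 2
  set C₁ : ℝ := 2 * μ ^ 2 * (C + 2 * K') with hC₁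
  have hC₁0 : 0 ≤ C₁ := by positivity
  have hall : ∀ᶠ n : ℕ in atTop,
      |(bridgeCount (d + 2) n : ℝ) / bridgeCount (d + 2) (n - 1) - μ| ≤ C₁ * (n : ℝ) ^ (-(a * δ)) := by
    filter_upwards [F1, F2, F3, F4, F7] with n hy hz hN0 hkn hn2
    have hn0 : (0 : ℝ) < n := by exact_mod_cast (show 0 < n by omega)
    have hn0' : (0 : ℝ) ≤ n := hn0.le
    set y : ℝ := (n : ℝ) ^ a with hydef
    set z : ℝ := (n : ℝ) ^ ((1 : ℝ) / 4) with hzdef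
    have hy2 : 2 ≤ y := le_trans (le_max_left _ _) hy
    have hyμ : μ ≤ y := le_trans (le_max_right _ _) hy
    have hy0 : 0 < y := by linarith
    have hyz : y ≤ z := Real.rpow_le_rpow_of_exponent_le (by exact_mod_cast (show 1 ≤ n by omega)) ha4
    have hn_eq : (n : ℝ) = z ^ 4 := by
      rw [hzdef, show ((1 : ℝ) / 4) = ((4 : ℕ) : ℝ)⁻¹ by norm_num, Real.rpow_inv_natCast_pow hn0' (by norm_num)]
    set T : ℕ := ⌊y⌋₊ with hTdef
    have hT1 : 1 ≤ T := (Nat.one_le_floor_iff y).2 (by linarith)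
    have hTy : (T : ℝ) ≤ y := Nat.floor_le hy0.le
    have hyT : y < T + 1 := Nat.lt_floor_add_one y
    have hwinR : (2 * (2 * T + 1) : ℝ) ≤ n := by
      rw [hn_eq]; have := four_mul_add_two_le_pow_four' hz; linarith
    have hwin : 2 * (2 * T + 1) ≤ n := by exact_mod_cast hwinR
    have hT : 2 * T + 1 ≤ n := by omega
    have h2Ty : y ≤ ((2 * T : ℕ) : ℝ) := by push_cast; linarith
    -- `η = 2K' n^{-1/4}`, `Tη ≤ kk n < 1/2`
    set η : ℝ := 2 * K' * (n : ℝ) ^ (-(1 : ℝ) / 4) with hηdef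
    have hη0 : 0 ≤ η := by rw [hηdef]; exact mul_nonneg (by linarith) (Real.rpow_nonneg hn0' _)
    have hTηk : (T : ℝ) * η ≤ kk n := by
      have e1 : y * η = kk n := by
        rw [hkk, hydef, hηdef]
        simp only
        rw [show -(a * δ) = a + (-(1 : ℝ) / 4) by linarith, Real.rpow_add hn0]
        ring
      calc (T : ℝ) * η ≤ y * η := mul_le_mul_of_nonneg_right hTy hη0
        _ = kk n := e1
    have hTη : (T : ℝ) * η ≤ 1 / 2 := by linarith
    -- the sharp sandwich for `a_n = b_n μ^{-n}`
    have hS := _root_.Literature.Probability.Process.Renewal.ratio_sandwich_sharp (renewalA (d + 2))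
      (renewalP (d + 2)) n T η hT1 hT hη0 hTη (fun k => (renewalA_pos (d + 2) k).le) (renewalP_nonneg (d + 2))
      (renewalA_pos (d + 2) n) (renewalA_pos (d + 2) (n - 1))
      (lt_of_lt_of_le (inv_pos.2 hμ) (inv_le_renewalP_one (d + 2))) (sum_renewalP_le_one (d + 2) _)
      (renewalA_eq_sum (d + 2)) (hup_bridges d hK' hU hwin hN0)
    set Eo := ∑ t ∈ range T, renewalP (d + 2) (2 * t + 1) with hEo
    have hEo : μ⁻¹ ≤ Eo := by
      have h1 : renewalP (d + 2) (2 * 0 + 1) ≤ Eo :=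
        Finset.single_le_sum (f := fun t => renewalP (d + 2) (2 * t + 1)) (fun t _ => renewalP_nonneg (d + 2) _)
          (Finset.mem_range.2 (by omega))
      exact le_trans (inv_le_renewalP_one (d + 2)) (by simpa using h1)
    have hEo_pos : 0 < Eo := lt_of_lt_of_le (inv_pos.2 hμ) hEo
    have hθ : 1 / 2 ≤ 1 - (T : ℝ) * η := by linarith
    -- the dropped mass under the tail rate: `ε ≤ C (2T)^{-δ} ≤ C n^{-aδ}`
    have h2T1 : 1 ≤ 2 * T := by omega
    have hε1 : 1 - ∑ k ∈ Icc 1 (2 * T), renewalP (d + 2) k ≤ C * (((2 * T : ℕ) : ℝ)) ^ (-δ) := hKT (2 * T) h2T1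
    have hpow1 : (((2 * T : ℕ) : ℝ)) ^ (-δ) ≤ (n : ℝ) ^ (-(a * δ)) := by
      have h1 : (((2 * T : ℕ) : ℝ)) ^ (-δ) ≤ y ^ (-δ) :=
        Real.rpow_le_rpow_of_nonpos hy0 h2Ty (by linarith)
      have h2 : y ^ (-δ) = (n : ℝ) ^ (-(a * δ)) := by
        rw [hydef, ← Real.rpow_mul hn0']; congr 1; ring
      rw [← h2]; exact h1
    have hε : 1 - ∑ k ∈ Icc 1 (2 * T), renewalP (d + 2) k ≤ C * (n : ℝ) ^ (-(a * δ)) :=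
      hε1.trans (mul_le_mul_of_nonneg_left hpow1 hC)
    have hkkn : kk n = 2 * K' * (n : ℝ) ^ (-(a * δ)) := rfl
    have hnum : (1 - ∑ k ∈ Icc 1 (2 * T), renewalP (d + 2) k) + T * η ≤ (C + 2 * K') * (n : ℝ) ^ (-(a * δ)) := by
      have := hTηk; rw [hkkn] at this; nlinarith
    have hnum0 : 0 ≤ (1 - ∑ k ∈ Icc 1 (2 * T), renewalP (d + 2) k) + T * η := by
      have := sum_renewalP_le_one (d + 2) (Icc 1 (2 * T))
      have := mul_nonneg (Nat.cast_nonneg T) hη0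
      linarith
    have hden : μ⁻¹ / 2 ≤ (1 - (T : ℝ) * η) * Eo := by
      have := mul_le_mul hθ hEo (inv_pos.2 hμ).le (by linarith)
      linarith
    have hden0 : 0 < μ⁻¹ / 2 := by positivity
    have hA : |renewalA (d + 2) n / renewalA (d + 2) (n - 1) - 1| ≤ 2 * μ * ((C + 2 * K') * (n : ℝ) ^ (-(a * δ))) := by
      refine hS.trans ?_
      calc ((1 - ∑ k ∈ Icc 1 (2 * T), renewalP (d + 2) k) + T * η) / ((1 - T * η) * Eo)
          ≤ ((1 - ∑ k ∈ Icc 1 (2 * T), renewalP (d + 2) k) + T * η) / (μ⁻¹ / 2) :=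
            div_le_div_of_nonneg_left hnum0 hden0 hden
        _ = 2 * μ * ((1 - ∑ k ∈ Icc 1 (2 * T), renewalP (d + 2) k) + T * η) := by
            field_simp
        _ ≤ 2 * μ * ((C + 2 * K') * (n : ℝ) ^ (-(a * δ))) := by gcongr
    -- convert to `b_n / b_{n-1}`
    have hconv : (bridgeCount (d + 2) n : ℝ) / bridgeCount (d + 2) (n - 1) - μ =
        μ * (renewalA (d + 2) n / renewalA (d + 2) (n - 1) - 1) := by
      obtain ⟨n', hn'⟩ : ∃ n', n = n' + 1 := ⟨n - 1, by omega⟩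
      subst hn'
      have hb0 : (0 : ℝ) < bridgeCount (d + 2) n' := by
        exact_mod_cast one_le_bridgeCount (d := d + 2) n'
      have haB : renewalA (d + 2) (n' + 1) / renewalA (d + 2) (n' + 1 - 1) =
          (bridgeCount (d + 2) (n' + 1) : ℝ) / (μ * bridgeCount (d + 2) n') := by
        simp only [renewalA, Nat.add_sub_cancel]
        rw [← hμdef, pow_succ]
        field_simp
      rw [haB, Nat.add_sub_cancel]
      field_simp
    rw [hconv, abs_mul, abs_of_pos hμ]
    calc μ * |renewalA (d + 2) n / renewalA (d + 2) (n - 1) - 1|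
        ≤ μ * (2 * μ * ((C + 2 * K') * (n : ℝ) ^ (-(a * δ)))) := mul_le_mul_of_nonneg_left hA hμ.le
      _ = C₁ * (n : ℝ) ^ (-(a * δ)) := by rw [hC₁]; ring
  -- shift the index and patch the finitely many small `N`
  obtain ⟨N₂, hN₂⟩ := eventually_atTop.1 ((tendsto_add_atTop_nat 1).eventually hall)
  set g : ℕ → ℝ := fun N => |(bridgeCount (d + 2) (N + 1) : ℝ) / bridgeCount (d + 2) N - μ| with hg
  have hg0 : ∀ N, 0 ≤ g N := fun N => abs_nonneg _
  set S : ℝ := ∑ N ∈ range N₂, g N with hS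
  have hS0 : 0 ≤ S := Finset.sum_nonneg fun N _ => hg0 N
  have hN2pos : (0 : ℝ) < (N₂ : ℝ) + 1 := by positivity
  refine ⟨C₁ + S * ((N₂ : ℝ) + 1) ^ (a * δ), fun N hN => ?_⟩
  have hNpos : (0 : ℝ) < N := by exact_mod_cast hN
  have hrN : 0 < (N : ℝ) ^ (-(a * δ)) := Real.rpow_pos_of_pos hNpos _
  rw [haδ] at *
  by_cases hcase : N₂ ≤ N
  · have h := hN₂ N hcase
    simp only [Nat.add_sub_cancel] at h
    have hmono : ((N + 1 : ℕ) : ℝ) ^ (-(δ / (4 * (1 + δ)))) ≤ (N : ℝ) ^ (-(δ / (4 * (1 + δ)))) :=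
      Real.rpow_le_rpow_of_nonpos hNpos (by push_cast; linarith) (by
        have : 0 < δ / (4 * (1 + δ)) := by positivity
        linarith)
    calc |(bridgeCount (d + 2) (N + 1) : ℝ) / bridgeCount (d + 2) N - μ|
        ≤ C₁ * ((N + 1 : ℕ) : ℝ) ^ (-(δ / (4 * (1 + δ)))) := h
      _ ≤ C₁ * (N : ℝ) ^ (-(δ / (4 * (1 + δ)))) := mul_le_mul_of_nonneg_left hmono hC₁0
      _ ≤ (C₁ + S * ((N₂ : ℝ) + 1) ^ (δ / (4 * (1 + δ)))) * (N : ℝ) ^ (-(δ / (4 * (1 + δ)))) := by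
          gcongr
          have : 0 ≤ S * ((N₂ : ℝ) + 1) ^ (δ / (4 * (1 + δ))) := by positivity
          linarith
  · have hmem : N ∈ range N₂ := Finset.mem_range.2 (by omega)
    have hle : g N ≤ S := Finset.single_le_sum (fun M _ => hg0 M) hmem
    -- `S ≤ S (N₂+1)^{aδ} N^{-aδ}` because `N ≤ N₂ + 1`
    have hone : 1 ≤ ((N₂ : ℝ) + 1) ^ (δ / (4 * (1 + δ))) * (N : ℝ) ^ (-(δ / (4 * (1 + δ)))) := by
      rw [Real.rpow_neg hNpos.le, ← div_eq_mul_inv, one_le_div (Real.rpow_pos_of_pos hNpos _)]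
      exact Real.rpow_le_rpow hNpos.le (by
        have : (N : ℝ) ≤ N₂ := by exact_mod_cast (show N ≤ N₂ by omega)
        linarith) (by positivity)
    calc |(bridgeCount (d + 2) (N + 1) : ℝ) / bridgeCount (d + 2) N - μ| = g N := rfl
      _ ≤ S := hle
      _ ≤ S * (((N₂ : ℝ) + 1) ^ (δ / (4 * (1 + δ))) * (N : ℝ) ^ (-(δ / (4 * (1 + δ))))) :=
          le_mul_of_one_le_right hS0 hone
      _ ≤ (C₁ + S * ((N₂ : ℝ) + 1) ^ (δ / (4 * (1 + δ)))) * (N : ℝ) ^ (-(δ / (4 * (1 + δ)))) := by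
          have : 0 ≤ C₁ * (N : ℝ) ^ (-(δ / (4 * (1 + δ)))) := mul_nonneg hC₁0 hrN.le
          nlinarith


end Literature.Probability.RandomPlanarGeometry.SAW.Zd

end
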